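import Summits.Parity.GeneralizedHardyLittlewood.Theses.ZDegreeToeplitzBand
import HarnessLib

/-!
# `ZDegreeToeplitzBand`: the typed layer is «(A) fails eventually» (negative lemmas, refuter)

Route `ZDegreeToeplitzBand` (cell landau-siegel §D, BIRTH (4)) closes `Zhang2022.Skeleton.Theorem1`
from three typed cruxes: K0 `InClassSideTables` (stmt-Parity-20016), K1 `PsiGradedTables`
(stmt-Parity-20014), K2 `PsiGradedTablesClose` (stmt-Parity-20015). Every table in them is an
(A)-GUARDED eventual statement (`ForAllLarge fun D _ χ => AssumptionA D χ → …`), so each is vacuous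
on the horn where (A) fails for all large moduli. This file records, at the level of the LEDGER
ITEMS as typed, the critic's C0 finding for the option-β package
(`KnifeEdge.gradedClosesPsi_iff_notAEventually_closed`, `KnifeEdgeLenZDegreePack` Part 4):

* `notAEventually_of_typedLayer` — K0 → K1 → K2 → «¬(A) eventually» (classically: on the recurring
  horn K1+K2 assemble the package `GradedClosesPsi c′` for all large `c′`, which with K0 gives
  ¬(A) eventually by the tree's closed equivalence — contradiction);
* `not_notAEventually_of_not_inClassSideTables` / `_psiGradedTables` / `_psiGradedTablesClose` —
  refuting ANY typed crux of the route is exhibiting (A) infinitely often (each crux is implied by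
  ¬(A) eventually: threshold `0`, the ZERO tables, resp. its own hypothesis);
* `typedLayer_iff_notAEventually` — the conjunction K0 ∧ K1 ∧ K2 is EQUIVALENT to ¬(A) eventually,
  and `theorem1_of_typedLayer` reaches Theorem 1 only through the tree's vacuous horn
  `theorem1_of_eventually_not_assumptionA`.

READING (refuter ls-ref-1 g4, VERDICTS §32): no typed item of this route has an unconditional
attack surface; each can close `proved` only through the route's informal α-items (explicit
functionals, their slot theorems, `GradedCloses` of those — (A)-free real analysis). Not a defect of
the route (the α/K split is its design); a statement of where its content lives. Standard axioms.
«The programme SEARCHES and TYPES; no claim about Landau–Siegel zeros, Theorems 1–2 of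
arXiv:2211.02515 or a repaired Margin232 until a kernel theorem says so.»

## References

* [Zhang2022LandauSiegel] Y. Zhang, Discrete mean estimates and the Landau–Siegel zero,
  arXiv:2211.02515v1 (2022): §2 p. 4 (Assumption (A), "for large D"), (2.16), §8 (8.5).
-/

namespace Summit.Parity.GeneralizedHardyLittlewood.Theorems.ZDegreeToeplitzBand.Negative

open Literature.NumberTheory.LFunctions.Zhang2022
open Literature.NumberTheory.LFunctions.Zhang2022.Skeleton
open Literature.NumberTheory.LFunctions.Zhang2022.KnifeEdge
open Summit.Parity.GeneralizedHardyLittlewood.Theses.ZDegreeToeplitzBand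

-- «¬(A) eventually» below = `ForAllLarge fun D _ χ => ¬ AssumptionA D χ` (Theorem 1's shape with constant 1),
-- spelled out in every statement so that this file declares no definition.

/-- Refuting K0 is exhibiting (A) infinitely often: K0 holds with threshold `0` whenever (A) fails
eventually (the guard of `InClassMean` is vacuous there). [cite: Zhang2022LandauSiegel, §2 p. 4, §7 Prop 7.1] -/
theorem not_notAEventually_of_not_inClassSideTables (h : ¬ InClassSideTables) : ¬ ForAllLarge fun D _ χ => ¬ AssumptionA D χ := by
  intro hA
  refine h ⟨0, fun _ _ => ?_⟩
  intro u u' _ ε _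
  exact hA.mono fun D _ χ _ _ hn ha => absurd ha hn

/-- Refuting K1 is exhibiting (A) infinitely often: K1 holds with the ZERO tables whenever (A) fails
eventually. [cite: Zhang2022LandauSiegel, §2 p. 4, §8 (8.5)] -/
theorem not_notAEventually_of_not_psiGradedTables (h : ¬ PsiGradedTables) : ¬ ForAllLarge fun D _ χ => ¬ AssumptionA D χ :=
  fun hA => h ⟨0, fun _ _ => ⟨0, 0, 0, crossTablePsi_of_notAEventually hA 1 0,
    dualCrossTablePsi_of_notAEventually hA 1 0, tauTwoTablePsi_of_notAEventually hA 0⟩⟩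

/-- Refuting K2 is exhibiting (A) infinitely often: K2's own hypothesis is «¬ ¬(A) eventually».
[cite: Zhang2022LandauSiegel, §2 p. 4] -/
theorem not_notAEventually_of_not_psiGradedTablesClose (h : ¬ PsiGradedTablesClose) : ¬ ForAllLarge fun D _ χ => ¬ AssumptionA D χ :=
  fun hA => h fun hA' => absurd hA hA'

/-- **K0 → K1 → K2 → ¬(A) eventually** (classically; the tree's closed equivalence for the package on
the recurring horn). Stronger in shape than the route's conclusion `Theorem1`.
[cite: Zhang2022LandauSiegel, §2 p. 4, p. 6, (2.16)] -/
theorem notAEventually_of_typedLayer (h0 : InClassSideTables) (h1 : PsiGradedTables)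
    (h2 : PsiGradedTablesClose) : ForAllLarge fun D _ χ => ¬ AssumptionA D χ := by
  by_contra hA
  obtain ⟨c₀, -, hiff⟩ := gradedClosesPsi_iff_notAEventually_closed
  obtain ⟨c₁, hK0⟩ := h0
  obtain ⟨c₂, hK1⟩ := h1
  obtain ⟨c₃, hK2⟩ := h2 hA
  have hc0 : c₀ ≤ max (max c₀ c₁) (max c₂ c₃) := le_trans (le_max_left _ _) (le_max_left _ _)
  have hc1 : c₁ ≤ max (max c₀ c₁) (max c₂ c₃) := le_trans (le_max_right _ _) (le_max_left _ _)
  have hc2 : c₂ ≤ max (max c₀ c₁) (max c₂ c₃) := le_trans (le_max_left _ _) (le_max_right _ _)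
  have hc3 : c₃ ≤ max (max c₀ c₁) (max c₂ c₃) := le_trans (le_max_right _ _) (le_max_right _ _)
  obtain ⟨X₁, Y₁, X₂, t1, t21, t2⟩ := hK1 _ hc2
  exact hA ((hiff _ hc0 (hK0 _ hc1)).1
    (gradedClosesPsi_of t1 t21 t2 (hK2 _ hc3 X₁ Y₁ X₂ t1 t21 t2)))

/-- **The typed layer of the route IS «¬(A) eventually», up to `↔`.**
[cite: Zhang2022LandauSiegel, §2 p. 4, (2.16)] -/
theorem typedLayer_iff_notAEventually :
    (InClassSideTables ∧ PsiGradedTables ∧ PsiGradedTablesClose) ↔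
      ForAllLarge fun D _ χ => ¬ AssumptionA D χ := by
  refine ⟨fun h => notAEventually_of_typedLayer h.1 h.2.1 h.2.2, fun hA => ?_⟩
  by_contra h
  simp only [not_and_or] at h
  rcases h with h | h | h
  · exact not_notAEventually_of_not_inClassSideTables h hA
  · exact not_notAEventually_of_not_psiGradedTables h hA
  · exact not_notAEventually_of_not_psiGradedTablesClose h hA

/-- Theorem 1 from the typed layer factors through the tree's vacuous horn.
[cite: Zhang2022LandauSiegel, §1 Theorem 1, §2 p. 4] -/
theorem theorem1_of_typedLayer (h0 : InClassSideTables) (h1 : PsiGradedTables)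
    (h2 : PsiGradedTablesClose) : Theorem1 :=
  theorem1_of_eventually_not_assumptionA (notAEventually_of_typedLayer h0 h1 h2)

end Summit.Parity.GeneralizedHardyLittlewood.Theorems.ZDegreeToeplitzBand.Negative
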